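import Mathlib
import Literature.NumberTheory.Transcendental.SemialgebraicMapsProofs
import Summits.KontsevichZagierPeriods.KontsevichZagierPeriods.Theorems.SoloInformedPolyJacobian
import Summits.KontsevichZagierPeriods.KontsevichZagierPeriods.Theorems.SoloInformedNashCubulation
import HarnessLib
import HarnessLib.Audit

/-!
# SoloInformed — from Nash triangulations to Nash cubulations

The monomial map `κ(s) = (s₁, s₁s₂, …, s₁⋯sₘ)` maps the open cube `(0,1)ᵐ` bijectively onto the
open ordered simplex `∇ᵐ = {1 > t₁ > ⋯ > tₘ > 0}` and the closed cube onto its closure, with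
polynomial Jacobian `∏ⱼ ∏_{l<j} s_l ≥ 0`. Consequently a **triangulation datum** for `K`
(finitely many injective `ℚ`-semialgebraic `C¹` charts `σᵢ : ∇ᵐ → K`, almost disjoint, covering
a.e., with `|det σᵢ'|` the real part of a germ over the CLOSED simplex) yields a cubulation datum
(`SoloInformedTriangulation.toCubulation`, charts `σᵢ ∘ κ`, germs `(Hᵢ ∘ κ) · det κ'`), and
`SoloInformedNashTriangulation → SoloInformedNashCubulation`
(`soloInformed_nashCubulation_of_nashTriangulation`); the transfer theorem follows in the form
`soloInformed_ayoubTransfer₉`. This puts the real-algebraic input of the Ayoub transfer in the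
language of strong Nash triangulations [Shiota 1984, Prop. 6.18; Shiota 1987, LNM 1269].
-/

noncomputable section

open scoped BigOperators
open Set MeasureTheory
open Literature.ModelTheory.ExponentialFields Literature.NumberTheory.Transcendental
open Literature.NumberTheory.Transcendental.KZ

namespace Summit.KontsevichZagierPeriods.KontsevichZagierPeriods.Theorems

variable {m : ℕ}

/-! ### Real estimates on the cube -/

/-- A product of factors in `[0,1]` lies in `[0,1]`. -/
theorem soloInformed_prod_filter_mem_Icc {x : Fin m → ℝ} (hx : x ∈ soloInformedCube m)
    (s : Finset (Fin m)) : 0 ≤ ∏ i ∈ s, x i ∧ ∏ i ∈ s, x i ≤ 1 :=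
  ⟨Finset.prod_nonneg fun i _ => (soloInformed_mem_cube_iff.1 hx i).1,
    Finset.prod_le_one (fun i _ => (soloInformed_mem_cube_iff.1 hx i).1)
      fun i _ => (soloInformed_mem_cube_iff.1 hx i).2⟩

/-- Prefix products of numbers in `[0,1]` are bounded by each factor. -/
theorem soloInformed_prefixProd_le_apply {x : Fin m → ℝ} (hx : x ∈ soloInformedCube m) (j : Fin m) :
    soloInformedPrefixProd x j ≤ x j := by
  rw [soloInformed_prefixProd_eq_mul]
  exact mul_le_of_le_one_right (soloInformed_mem_cube_iff.1 hx j).1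
    (soloInformed_prod_filter_mem_Icc hx _).2

/-- Prefix products of numbers in `[0,1]` decrease with the index. -/
theorem soloInformed_prefixProd_antitone {x : Fin m → ℝ} (hx : x ∈ soloInformedCube m)
    {i j : Fin m} (hij : i ≤ j) : soloInformedPrefixProd x j ≤ soloInformedPrefixProd x i := by
  have hsub : Finset.univ.filter (fun l : Fin m => l ≤ i) ⊆
      Finset.univ.filter (fun l : Fin m => l ≤ j) := by
    intro l; simp only [Finset.mem_filter, Finset.mem_univ, true_and]; exact fun h => h.trans hij
  rw [soloInformedPrefixProd, soloInformedPrefixProd, ← Finset.prod_sdiff hsub]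
  exact mul_le_of_le_one_left (soloInformed_prod_filter_mem_Icc hx _).1
    (soloInformed_prod_filter_mem_Icc hx _).2

/-- Prefix products of positive numbers are positive. -/
theorem soloInformed_prefixProd_pos {x : Fin m → ℝ} (hx : x ∈ soloInformedOpenCube m) (j : Fin m) :
    0 < soloInformedPrefixProd x j :=
  Finset.prod_pos fun i _ => (hx i).1

/-- Prefix products of numbers in `(0,1)` strictly decrease with the index. -/
theorem soloInformed_prefixProd_strictAnti {x : Fin m → ℝ} (hx : x ∈ soloInformedOpenCube m)
    {i j : Fin m} (hij : i < j) : soloInformedPrefixProd x j < soloInformedPrefixProd x i := by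
  have hsub : Finset.univ.filter (fun l : Fin m => l ≤ i) ⊆
      Finset.univ.filter (fun l : Fin m => l ≤ j) := by
    intro l; simp only [Finset.mem_filter, Finset.mem_univ, true_and]
    exact fun h => h.trans hij.le
  have hxc := soloInformedOpenCube_subset_cube m hx
  rw [soloInformedPrefixProd, soloInformedPrefixProd, ← Finset.prod_sdiff hsub]
  refine mul_lt_of_lt_one_left (Finset.prod_pos fun l _ => (hx l).1) ?_
  have hj : j ∈ Finset.univ.filter (fun l : Fin m => l ≤ j) \
      Finset.univ.filter (fun l : Fin m => l ≤ i) := by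
    simp only [Finset.mem_sdiff, Finset.mem_filter, Finset.mem_univ, true_and, le_refl, not_le]
    exact hij
  rw [← Finset.mul_prod_erase _ _ hj]
  exact (mul_le_of_le_one_right (hx j).1.le (soloInformed_prod_filter_mem_Icc hxc _).2).trans_lt
    (hx j).2

/-! ### The ordered simplex and the monomial map -/

/-- The open ordered simplex `∇ᵐ = {t | 1 > t₁ > t₂ > ⋯ > tₘ > 0}`. -/
def soloInformedOrdSimplex (m : ℕ) : Set (Fin m → ℝ) :=
  {t | (∀ j, 0 < t j ∧ t j < 1) ∧ ∀ ⦃i j : Fin m⦄, i < j → t j < t i}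

/-- The closed ordered simplex `{t | 1 ≥ t₁ ≥ ⋯ ≥ tₘ ≥ 0}`. -/
def soloInformedOrdSimplexC (m : ℕ) : Set (Fin m → ℝ) :=
  {t | (∀ j, 0 ≤ t j ∧ t j ≤ 1) ∧ ∀ ⦃i j : Fin m⦄, i ≤ j → t j ≤ t i}

/-- The monomial map `κ(s)ⱼ = ∏_{i ≤ j} sᵢ`. -/
def soloInformedKappaMap (m : ℕ) : (Fin m → ℝ) → (Fin m → ℝ) :=
  soloInformedPolyMap (soloInformedMonoPoly m)

/-- Evaluation formula for the cube-to-ordered-simplex map `κ`. -/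
theorem soloInformedKappa_apply (x : Fin m → ℝ) (j : Fin m) :
    soloInformedKappaMap m x j = soloInformedPrefixProd x j := by
  simp [soloInformedKappaMap, soloInformed_aeval_monoPoly]

/-- `κ` maps the closed cube into the closed ordered simplex. -/
theorem soloInformed_mapsTo_kappa_cube (m : ℕ) :
    MapsTo (soloInformedKappaMap m) (soloInformedCube m) (soloInformedOrdSimplexC m) := fun x hx =>
  ⟨fun j => by
    rw [soloInformedKappa_apply]
    exact ⟨(soloInformed_prod_filter_mem_Icc hx _).1, (soloInformed_prod_filter_mem_Icc hx _).2⟩,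
  fun i j hij => by
    rw [soloInformedKappa_apply, soloInformedKappa_apply]
    exact soloInformed_prefixProd_antitone hx hij⟩

/-- `κ` maps the open cube into the open ordered simplex. -/
theorem soloInformed_mapsTo_kappa_openCube (m : ℕ) :
    MapsTo (soloInformedKappaMap m) (soloInformedOpenCube m) (soloInformedOrdSimplex m) :=
  fun x hx => ⟨fun j => by
    rw [soloInformedKappa_apply]
    exact ⟨soloInformed_prefixProd_pos hx j, (soloInformed_prefixProd_le_apply
      (soloInformedOpenCube_subset_cube m hx) j).trans_lt (hx j).2⟩,
  fun i j hij => by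
    rw [soloInformedKappa_apply, soloInformedKappa_apply]
    exact soloInformed_prefixProd_strictAnti hx hij⟩

/-- `κ` is injective on the open cube. -/
theorem soloInformed_injOn_kappa (m : ℕ) :
    InjOn (soloInformedKappaMap m) (soloInformedOpenCube m) :=
  fun x hx x' _ h => soloInformed_prefixProd_injective (fun j => (hx j).1.ne') fun j => by
    rw [← soloInformedKappa_apply, ← soloInformedKappa_apply, h]

/-- **`κ` maps the open cube ONTO the open ordered simplex.** -/
theorem soloInformed_image_kappa (m : ℕ) :
    soloInformedKappaMap m '' soloInformedOpenCube m = soloInformedOrdSimplex m := by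
  refine Subset.antisymm (fun t ⟨x, hx, hxt⟩ => hxt ▸ soloInformed_mapsTo_kappa_openCube m hx)
    fun t ht => ⟨soloInformedPrefixInv t, fun j => ?_, funext fun j => ?_⟩
  · by_cases h : j.1 = 0
    · simpa [soloInformedPrefixInv, h] using ht.1 j
    · have hlt : (⟨j.1 - 1, by omega⟩ : Fin m) < j := Fin.lt_def.2 (by simp; omega)
      simp only [soloInformedPrefixInv, h, ↓reduceDIte]
      exact ⟨div_pos (ht.1 j).1 (ht.1 _).1, (div_lt_one (ht.1 _).1).2 (ht.2 hlt)⟩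
  · rw [soloInformedKappa_apply]
    exact soloInformed_prefixProd_prefixInv t (fun j => (ht.1 j).1.ne') j

/-! ### Dominance of `κ`: the substitution `θ_κ` is injective -/

/-- **`θ_κ` is injective**: `Q(κ(s), T) = 0 ⇒ Q = 0` (every `z ∈ ℚᵐ` with non-zero coordinates is
a `κ(s)`, so `Q · ∏ zⱼ` vanishes on `ℚᵐ⁺¹`). -/
theorem soloInformed_subst_kappa_injective (m : ℕ) (Q : MvPolynomial (Fin (m + 1)) ℚ)
    (hQ : soloInformedSubst (soloInformedMonoPoly m) Q = 0) : Q = 0 := by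
  set R : MvPolynomial (Fin (m + 1)) ℚ := ∏ j : Fin m, MvPolynomial.X (Fin.castSucc j) with hR
  have hR0 : R ≠ 0 := Finset.prod_ne_zero_iff.mpr fun j _ => MvPolynomial.X_ne_zero _
  have hQR : Q * R = 0 := by
    apply MvPolynomial.funext
    intro y
    rw [map_zero, map_mul]
    by_cases hy : ∀ j : Fin m, y (Fin.castSucc j) ≠ 0
    · have h1 := soloInformed_aeval_subst (soloInformedMonoPoly m)
        (soloInformedPrefixInv fun j => y (Fin.castSucc j)) (y (Fin.last m)) Q
      rw [hQ, map_zero] at h1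
      have h2 : (Fin.snoc (α := fun _ => ℚ) (fun j => MvPolynomial.aeval
          (soloInformedPrefixInv fun j => y (Fin.castSucc j)) (soloInformedMonoPoly m j))
          (y (Fin.last m))) = y := by
        funext l
        induction l using Fin.lastCases with
        | last => simp
        | cast j =>
          simp only [Fin.snoc_castSucc, soloInformed_aeval_monoPoly]
          exact soloInformed_prefixProd_prefixInv _ hy j
      rw [h2] at h1
      rw [show MvPolynomial.eval y Q = MvPolynomial.aeval y Q from rfl, ← h1, zero_mul]
    · push Not at hy
      obtain ⟨j, hj⟩ := hy
      rw [hR, map_prod, Finset.prod_eq_zero (Finset.mem_univ j) (by simpa using hj), mul_zero]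
  exact (mul_eq_zero.1 hQR).resolve_right hR0

/-! ### The Jacobian of `κ` -/

/-- A variable outside the index set does not occur in the product of the indexed variables. -/
theorem soloInformed_notMem_vars_prod_X {s : Finset (Fin m)} {i : Fin m} (hi : i ∉ s) :
    i ∉ (∏ l ∈ s, (MvPolynomial.X l : MvPolynomial (Fin m) ℚ)).vars := by
  classical
  intro h
  have h' := MvPolynomial.vars_prod (fun l => (MvPolynomial.X l : MvPolynomial (Fin m) ℚ)) h
  simp only [Finset.mem_biUnion, MvPolynomial.vars_X, Finset.mem_singleton] at h'
  obtain ⟨l, hl, rfl⟩ := h'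
  exact hi hl

/-- The symbolic Jacobian of `κ` is lower triangular … -/
theorem soloInformed_jacPoly_kappa_of_lt {i j : Fin m} (hij : i < j) :
    soloInformedJacMat (soloInformedMonoPoly m) i j = 0 := by
  rw [soloInformedJacMat_apply]
  refine MvPolynomial.pderiv_eq_zero_of_notMem_vars (soloInformed_notMem_vars_prod_X ?_)
  simp [not_le.2 hij]

/-- … with diagonal entries `∏_{l < j} X_l`. -/
theorem soloInformed_jacPoly_kappa_diag (j : Fin m) :
    soloInformedJacMat (soloInformedMonoPoly m) j j =
      ∏ l ∈ Finset.univ.filter (fun l : Fin m => l < j), MvPolynomial.X l := by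
  rw [soloInformedJacMat_apply, soloInformedMonoPoly, soloInformed_prefixProd_eq_mul,
    MvPolynomial.pderiv_mul, MvPolynomial.pderiv_X_self, one_mul,
    MvPolynomial.pderiv_eq_zero_of_notMem_vars (soloInformed_notMem_vars_prod_X (by simp)),
    mul_zero, add_zero]

/-- The Jacobian determinant polynomial of `κ`: `∏ⱼ ∏_{l<j} X_l`. -/
theorem soloInformed_det_jacPoly_kappa (m : ℕ) :
    (soloInformedJacMat (soloInformedMonoPoly m)).det =
      ∏ j : Fin m, ∏ l ∈ Finset.univ.filter (fun l : Fin m => l < j), MvPolynomial.X l := by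
  rw [Matrix.det_of_lowerTriangular _ fun i j hij =>
    soloInformed_jacPoly_kappa_of_lt (OrderDual.toDual_lt_toDual.1 hij)]
  exact Finset.prod_congr rfl fun j _ => soloInformed_jacPoly_kappa_diag j

/-- The Jacobian determinant of `κ` at `x`: `∏ⱼ ∏_{l<j} x_l`, non-negative on the cube. -/
theorem soloInformed_det_jacCLM_kappa (x : Fin m → ℝ) :
    (soloInformedJacCLM (soloInformedMonoPoly m) x).det =
      ∏ j : Fin m, ∏ l ∈ Finset.univ.filter (fun l : Fin m => l < j), x l := by
  rw [soloInformed_det_jacCLM, soloInformed_det_jacPoly_kappa]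
  simp [map_prod]

/-- The Jacobian determinant of `κ` is non-negative on the closed cube. -/
theorem soloInformed_det_jacCLM_kappa_nonneg {x : Fin m → ℝ} (hx : x ∈ soloInformedCube m) :
    0 ≤ (soloInformedJacCLM (soloInformedMonoPoly m) x).det := by
  rw [soloInformed_det_jacCLM_kappa]
  exact Finset.prod_nonneg fun j _ => (soloInformed_prod_filter_mem_Icc hx _).1

/-- The Jacobian germ of `κ`: the polynomial germ of `det (∂κ/∂s)` over the cube. -/
def soloInformedKappaJacGerm (m : ℕ) : SoloInformedGermOn m (soloInformedCube m) :=
  soloInformedPolyGermOn (soloInformedCube m) (soloInformedJacMat (soloInformedMonoPoly m)).det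

/-- Real part of the Jacobian germ of `κ` at real points. -/
theorem soloInformed_kappaJacGerm_re (x : Fin m → ℝ) :
    ((soloInformedKappaJacGerm m).g (soloInformedToC m x)).re =
      (soloInformedJacCLM (soloInformedMonoPoly m) x).det := by
  rw [soloInformedKappaJacGerm, soloInformedPolyGermOn_g, soloInformed_det_jacCLM,
    show soloInformedToC m x = fun i => ((x i : ℝ) : ℂ) from rfl, ← soloInformed_ofReal_aeval,
    Complex.ofReal_re]

/-! ### Triangulation data and the cubulation they induce -/

/-- A **Nash triangulation datum** for `K ⊆ ℝᵐ`: finitely many injective `ℚ`-semialgebraic `C¹`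
charts from the open ordered simplex `∇ᵐ` onto almost-disjoint pieces of `K` covering `K` a.e.,
with `|det σᵢ'|` on `∇ᵐ` the real part of a germ over the CLOSED ordered simplex. -/
structure SoloInformedTriangulation {m : ℕ} (K : Set (Fin m → ℝ)) where
  /-- number of simplices -/
  k : ℕ
  /-- the charts -/
  σ : Fin k → (Fin m → ℝ) → (Fin m → ℝ)
  /-- their derivatives on the open simplex -/
  σ' : Fin k → (Fin m → ℝ) → ((Fin m → ℝ) →L[ℝ] (Fin m → ℝ))
  /-- the germs giving the Jacobians -/
  H : Fin k → SoloInformedGermOn m (soloInformedOrdSimplexC m)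
  semialgebraic : ∀ i, IsSemialgebraicMapOn ℚ (soloInformedOrdSimplex m) (σ i)
  hasFDerivWithinAt : ∀ i, ∀ t ∈ soloInformedOrdSimplex m,
    HasFDerivWithinAt (σ i) (σ' i t) (soloInformedOrdSimplex m) t
  injOn : ∀ i, InjOn (σ i) (soloInformedOrdSimplex m)
  subset : ∀ i, σ i '' soloInformedOrdSimplex m ⊆ K
  almostDisjoint : ∀ i j, i ≠ j →
    volume (σ i '' soloInformedOrdSimplex m ∩ σ j '' soloInformedOrdSimplex m) = 0
  cover : volume (K \ ⋃ i, σ i '' soloInformedOrdSimplex m) = 0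
  jacobian : ∀ i, ∀ t ∈ soloInformedOrdSimplex m,
    ((H i).g (soloInformedToC m t)).re = |(σ' i t).det|

/-- **Strong Nash triangulation of `ℚ`-semialgebraic sets** (registered obligation): every
`ℚ`-semialgebraic subset of the unit cube admits a Nash triangulation datum.
[Shiota 1984, Prop. 6.18; Shiota 1987, LNM 1269, Ch. I §3] plus embedded resolution over `ℚ`
[Hironaka 1964; Bierstone–Milman 1997] for the analyticity of the Jacobians at the boundary. -/
@[conjecture] def SoloInformedNashTriangulation : Prop :=
  ∀ (m : ℕ) (K : Set (Fin m → ℝ)), IsSemialgebraic ℚ K → K ⊆ soloInformedCube m →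
    Nonempty (SoloInformedTriangulation K)

namespace SoloInformedTriangulation

variable {K : Set (Fin m → ℝ)} (T : SoloInformedTriangulation K)

/-- The cube charts `Φᵢ = σᵢ ∘ κ`. -/
def cubeChart (i : Fin T.k) : (Fin m → ℝ) → (Fin m → ℝ) := T.σ i ∘ soloInformedKappaMap m

/-- The image of the open cube under the chart is the prescribed cell. -/
theorem image_cubeChart (i : Fin T.k) :
    T.cubeChart i '' soloInformedOpenCube m = T.σ i '' soloInformedOrdSimplex m := by
  rw [cubeChart, image_comp, soloInformed_image_kappa]

/-- The cube germs `(Hᵢ ∘ κ) · det(∂κ/∂s)`. -/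
def cubeGerm (i : Fin T.k) : SoloInformedCubeGerm m :=
  (((T.H i).comp (soloInformedMonoPoly m) (soloInformed_mapsTo_kappa_cube m)
    (soloInformed_subst_kappa_injective m)).mul (soloInformedKappaJacGerm m)).toCubeGerm

/-- **The cubulation induced by a triangulation.** -/
def toCubulation : SoloInformedCubulation K where
  k := T.k
  Φ := T.cubeChart
  Φ' i s := (T.σ' i (soloInformedKappaMap m s)).comp (soloInformedJacCLM (soloInformedMonoPoly m) s)
  G := T.cubeGerm
  semialgebraic i :=
    IsSemialgebraicMapOn.comp_holds (T.semialgebraic i)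
      (isSemialgebraicMapOn_aeval (isSemialgebraic_soloInformedOpenCube m) (soloInformedMonoPoly m))
      (soloInformed_mapsTo_kappa_openCube m)
  hasFDerivWithinAt i s hs :=
    (T.hasFDerivWithinAt i _ (soloInformed_mapsTo_kappa_openCube m hs)).comp s
      (soloInformed_hasFDerivAt_polyMap (soloInformedMonoPoly m) s).hasFDerivWithinAt
      (soloInformed_mapsTo_kappa_openCube m)
  injOn i := (T.injOn i).comp (soloInformed_injOn_kappa m) (soloInformed_mapsTo_kappa_openCube m)
  subset i := by rw [image_cubeChart]; exact T.subset i
  almostDisjoint i j hij := by rw [image_cubeChart, image_cubeChart]; exact T.almostDisjoint i j hij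
  cover := by
    have h : (⋃ i, T.cubeChart i '' soloInformedOpenCube m) =
        ⋃ i, T.σ i '' soloInformedOrdSimplex m :=
      iUnion_congr fun i => T.image_cubeChart i
    rw [h]
    exact T.cover
  jacobian i s hs := by
    have hsc := soloInformedOpenCube_subset_cube m hs
    have hκ := soloInformed_mapsTo_kappa_openCube m hs
    rw [ContinuousLinearMap.det, ContinuousLinearMap.toLinearMap_comp, LinearMap.det_comp, abs_mul]
    change (((((T.H i).comp (soloInformedMonoPoly m) (soloInformed_mapsTo_kappa_cube m)
      (soloInformed_subst_kappa_injective m)).mul (soloInformedKappaJacGerm m)).g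
        (soloInformedToC m s)).re) = _
    rw [SoloInformedGermOn.mul_re _ _ s ⟨((T.H i).comp _ _ _).mapsTo hsc,
      (soloInformedKappaJacGerm m).mapsTo hsc⟩, SoloInformedGermOn.comp_g,
      ← soloInformed_toC_polyMap, soloInformed_kappaJacGerm_re,
      abs_of_nonneg (soloInformed_det_jacCLM_kappa_nonneg hsc)]
    congr 1
    exact T.jacobian i _ hκ

end SoloInformedTriangulation

/-- **Nash triangulation ⇒ Nash cubulation.** -/
theorem soloInformed_nashCubulation_of_nashTriangulation (hT : SoloInformedNashTriangulation) :
    SoloInformedNashCubulation := fun m K hK hKc =>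
  let ⟨T⟩ := hT m K hK hKc
  ⟨T.toCubulation⟩

/-- **Transfer theorem, ninth form**: separation of poles [Viu-Sos 2021, Cor. 2.2] + strong Nash
triangulation of `ℚ`-semialgebraic sets + faithfulness of Ayoub's presentation up to torsion
imply the Kontsevich–Zagier period conjecture. -/
theorem soloInformed_ayoubTransfer₉ (H₂ : SoloInformedSeparationOfPoles)
    (hT : SoloInformedNashTriangulation) (hA : SoloInformedAyoubKZeffQ) :
    KontsevichZagierPeriods :=
  soloInformed_ayoubTransfer₈ H₂ (soloInformed_nashCubulation_of_nashTriangulation hT) hA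

end Summit.KontsevichZagierPeriods.KontsevichZagierPeriods.Theorems
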